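import Literature.NumberTheory.GaloisRepresentations.SuperellipticReductionPic
import Literature.NumberTheory.GaloisRepresentations.SuperellipticPicThreeTorsion
import HarnessLib
/-!
# Good reduction of `Pic(C_f)` for `y³ = f(x)` at `𝔓 ∤ 3`: the Serre–Tate datum, proved

`superelliptic_three_exists_reduction`: for a number field `K ∋ ζ₃`, `f = f₀ ⊗ K` separable with `3 ∤ deg f`, and a
maximal `𝔓 ⊂ ℤ̄` above `𝔭 ∌ 3` such that `f₀ mod 𝔭` is separable of the same degree, Deuring's explicit reduction
map `red = redPic 𝔭 𝔓 : Pic(C_{f,K̄}) →+ Pic(C_{f̄, ℤ̄/𝔓})` is `D_𝔓`-equivariant, commutes with the deck groups, and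
is injective and surjective on the `3`-power torsion (injective on `J[1-ζ]` explicitly, then on all `3ⁿ`-torsion
formally, `geomPic_eq_zero_of_three_pow_smul_eq_zero`; surjective by the equality of the counts
`#Pic[3ⁿ] = 3^{2(deg f-1)n}` on both fibres, `natCard_torsionBy_three_pow`).  This is the good-reduction
hypothesis `hX2` of `PicardLambdaAdicRepDivisible.picard_exists_reduction_bij` (there an assumption, quoted from
Serre–Tate 1968 §1 Lemma 2 for the Jacobian), in exactly the form consumed there, now a theorem.

## References
* [cite: Deuring1942Reduktion, §4]
* [cite: SerreTate1968GoodReduction, §1, Lemma 2]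
-/

noncomputable section

open Polynomial
open scoped NumberField Classical Polynomial.Bivariate Pointwise

namespace Literature.NumberTheory.GaloisRepresentations

open Field IsDedekindDomain Literature.NumberTheory.DiophantineGeometry
  Literature.NumberTheory.DiophantineGeometry.AlgFunctionField SuperellipticFunctionField SuperellipticReduction

attribute [local instance] Ideal.Quotient.field

set_option synthInstance.maxHeartbeats 160000

/-- **Good reduction of the divisor class group of `C_f : y³ = f(x)` at a prime `𝔓 ∤ 3` of good reduction**
(Deuring 1942, made explicit): for a number field `K ∋ ζ₃`, `f = f₀ ⊗ K` with `f₀ ∈ 𝓞_K[X]` separable, `3 ∤ deg f`,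
and a prime `𝔓` of `ℤ̄` above `𝔭 ∌ 3` with `f₀ mod 𝔭` separable of the same degree, the explicit reduction of
divisors (`SuperellipticReduction.redDiv`: reduce the coordinates of `𝔓`-integral points, send the other places to
`∞̄`) induces a homomorphism `red : Pic(C_{f,K̄}) → Pic(C_{f̄, ℤ̄/𝔓})` (`redPic`; principal divisors go to principal
divisors by `isPrincipal_redDiv_principalDivisor`) which is equivariant for the decomposition group `D_𝔓 → Aut((ℤ̄/𝔓)/(𝓞_K/𝔭))`
and for the deck groups `μ₃(K̄) → μ₃(ℤ̄/𝔓)`, injective on the `3`-power torsion (injective on `J[1-ζ]`, where the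
classes `[T_α - ∞]` reduce to `[T_ᾱ - ∞̄]`, then formally on all `3ⁿ`-torsion) and surjective on it (both sides have
`3^{2(deg f - 1)n}` elements).  This is the good-reduction datum `hX2` of `PicardLambdaAdicRepDivisible`
(Serre–Tate 1968 §1 Lemma 2 for the Jacobian), proved here for `ℓ = p = 3` without the Jacobian.
[cite: Deuring1942Reduktion, §4] [cite: SerreTate1968GoodReduction, §1, Lemma 2] -/
theorem superelliptic_three_exists_reduction (K : Type) [Field K] [NumberField K] {ζ : K} (hζ : IsPrimitiveRoot ζ 3)
    (f : K[X]) (f₀ : (𝓞 K)[X]) (hf : f₀.map (algebraMap (𝓞 K) K) = f) (hsep : f.Separable)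
    (𝔭 : HeightOneSpectrum (𝓞 K)) (𝔓 : Ideal (absIntegers (𝓞 K) K)) [𝔓.IsMaximal] [𝔓.LiesOver 𝔭.asIdeal]
    (h3𝔭 : (3 : 𝓞 K) ∉ 𝔭.asIdeal) (hndvd : ¬ 3 ∣ f.natDegree)
    (hdeg : (f₀.map (Ideal.Quotient.mk 𝔭.asIdeal)).natDegree = f.natDegree)
    (hsep𝔭 : (f₀.map (Ideal.Quotient.mk 𝔭.asIdeal)).Separable)
    [Fact (Irreducible (superellipticPoly K (AlgebraicClosure K) 3 f))]
    [Fact (Irreducible (superellipticPoly (𝓞 K ⧸ 𝔭.asIdeal) (absIntegers (𝓞 K) K ⧸ 𝔓) 3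
      (f₀.map (Ideal.Quotient.mk 𝔭.asIdeal))))] :
    ∃ red : GeomPic K 3 f →+
        SuperellipticPic (𝓞 K ⧸ 𝔭.asIdeal) (absIntegers (𝓞 K) K ⧸ 𝔓) 3 (f₀.map (Ideal.Quotient.mk 𝔭.asIdeal)),
      (∀ (τ : MulAction.stabilizer (absoluteGaloisGroup K) 𝔓) (c : GeomPic K 3 f),
          red ((τ : absoluteGaloisGroup K) • c) =
            (Ideal.Quotient.stabilizerHom 𝔓 𝔭.asIdeal (absoluteGaloisGroup K) τ) • red c) ∧
      (∀ (ξ : CyclicCoverDeck (AlgebraicClosure K) 3) (c : GeomPic K 3 f),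
          red (ξ • c) = CyclicCoverDeck.reduceMod K 3 𝔓 ξ • red c) ∧
      (∀ (n : ℕ) (c : GeomPic K 3 f), 3 ^ n • c = 0 → red c = 0 → c = 0) ∧
      (∀ (n : ℕ) c', 3 ^ n • c' = 0 → ∃ c : GeomPic K 3 f, 3 ^ n • c = 0 ∧ red c = c') := by
  subst hf
  haveI : Fact (Nat.Prime 3) := ⟨Nat.prime_three⟩
  haveI : IsAlgClosed (absIntegers (𝓞 K) K ⧸ 𝔓) := absIntegers.isAlgClosed_quotient 𝔓
  -- the standing hypotheses of `SuperellipticReduction`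
  have hp𝔭 : ((3 : ℕ) : 𝓞 K) ∉ 𝔭.asIdeal := by exact_mod_cast h3𝔭
  have hζ₀ : IsPrimitiveRoot (algebraMap K (AlgebraicClosure K) ζ) 3 := isPrimitiveRoot_algebraMap_algebraicClosure hζ
  obtain ⟨ζ₀', hζ₀'⟩ := exists_isPrimitiveRoot_residue (K := K) (𝔓 := 𝔓) hp𝔭
  have hdegK : (f₀.map (algebraMap (𝓞 K) K)).natDegree = f₀.natDegree :=
    natDegree_map_eq_of_injective NumberField.RingOfIntegers.coe_injective f₀
  have hdeg' : (f₀.map (Ideal.Quotient.mk 𝔭.asIdeal)).natDegree = f₀.natDegree := hdeg.trans hdegK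
  have hndvdk : ¬ 3 ∣ (f₀.map (Ideal.Quotient.mk 𝔭.asIdeal)).natDegree := by rw [hdeg]; exact hndvd
  have hle := principalDivisors_le_comap_redDiv (𝔓 := 𝔓) hp𝔭 hζ₀ hζ₀' hsep hsep𝔭 hndvdk
  refine ⟨redPic 𝔭 𝔓, redPic_smul hp𝔭 hζ₀ hζ₀' hsep hsep𝔭 hndvdk,
    redPic_deck_smul hp𝔭 hζ₀ hζ₀' hsep hsep𝔭 hndvdk, ?_, ?_⟩
  · -- injective on `3`-power torsion
    intro n c h3c hc
    refine geomPic_eq_zero_of_three_pow_smul_eq_zero hζ hsep hndvd (redPic 𝔭 𝔓)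
      (DistribSMul.toAddMonoidHom _ (CyclicCoverDeck.reduceMod K 3 𝔓 (deckGen hζ)))
      (fun c => redPic_deck_smul hp𝔭 hζ₀ hζ₀' hsep hsep𝔭 hndvdk (deckGen hζ) c)
      (fun c hc h0 => eq_zero_of_mem_lambdaTorsion_of_redPic_eq_zero hζ₀ hζ₀' hsep hsep𝔭 hndvd hndvdk hdeg' hle hc h0)
      n h3c hc
  · -- surjective on `3`-power torsion, by counting
    intro n c' hc'
    set T := AddSubgroup.torsionBy (GeomPic K 3 (f₀.map (algebraMap (𝓞 K) K))) (3 ^ n : ℕ) with hT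
    set T' := AddSubgroup.torsionBy (SuperellipticPic (𝓞 K ⧸ 𝔭.asIdeal) (absIntegers (𝓞 K) K ⧸ 𝔓) 3
      (f₀.map (Ideal.Quotient.mk 𝔭.asIdeal))) (3 ^ n : ℕ) with hT'
    have hcard : Nat.card T = 3 ^ (2 * ((f₀.map (algebraMap (𝓞 K) K)).natDegree - 1) * n) :=
      natCard_torsionBy_three_pow hζ₀ hsep hndvd n
    have hcard' : Nat.card T' = 3 ^ (2 * ((f₀.map (algebraMap (𝓞 K) K)).natDegree - 1) * n) := by
      rw [natCard_torsionBy_three_pow hζ₀' hsep𝔭 hndvdk n, hdeg]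
    haveI : Finite T' := Nat.finite_of_card_ne_zero (by rw [hcard']; exact pow_ne_zero _ three_ne_zero)
    set φ : T → T' := fun c => ⟨redPic 𝔭 𝔓 c, AddSubgroup.torsionBy.nsmul_iff.2 (by
      rw [← map_nsmul, AddSubgroup.torsionBy.nsmul_iff.1 c.2, map_zero])⟩ with hφ
    have hinj : Function.Injective φ := by
      rintro ⟨c₁, hc₁⟩ ⟨c₂, hc₂⟩ h
      have h' : redPic 𝔭 𝔓 (c₁ - c₂) = 0 := by
        rw [map_sub, sub_eq_zero]; exact congrArg Subtype.val h
      have h3 : 3 ^ n • (c₁ - c₂) = 0 := by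
        rw [smul_sub, AddSubgroup.torsionBy.nsmul_iff.1 hc₁, AddSubgroup.torsionBy.nsmul_iff.1 hc₂, sub_zero]
      exact Subtype.ext (sub_eq_zero.1 (geomPic_eq_zero_of_three_pow_smul_eq_zero hζ hsep hndvd (redPic 𝔭 𝔓)
        (DistribSMul.toAddMonoidHom _ (CyclicCoverDeck.reduceMod K 3 𝔓 (deckGen hζ)))
        (fun c => redPic_deck_smul hp𝔭 hζ₀ hζ₀' hsep hsep𝔭 hndvdk (deckGen hζ) c)
        (fun c hc h0 => eq_zero_of_mem_lambdaTorsion_of_redPic_eq_zero hζ₀ hζ₀' hsep hsep𝔭 hndvd hndvdk hdeg' hle hc h0)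
        n h3 h'))
    have hbij : Function.Bijective φ := hinj.bijective_of_nat_card_le (by rw [hcard, hcard'])
    obtain ⟨⟨c, hc⟩, hcc'⟩ := hbij.2 ⟨c', AddSubgroup.torsionBy.nsmul_iff.2 hc'⟩
    exact ⟨c, AddSubgroup.torsionBy.nsmul_iff.1 hc, congrArg Subtype.val hcc'⟩

end Literature.NumberTheory.GaloisRepresentations
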